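import Summits.AnomalousDissipation.AnomalousDissipation.Theorems.NeutralTaylorWavesTaylorWaveQuasiSteadyHierarchyEnergy

/-!
# Potential form of the ε-free hierarchy: two-scale curls are formally divergence-free
# (line `windfibred`, rev 3; crux stmt-AnomalousDissipation-16293, `NeutralTaylorWaves.TaylorWaveQuasiSteady`)

The open core `stub_hierarchyW` asks in particular for profiles `P_a : T⁴ → ℝ³` with `divCoeff j G N P s ≡ 0` for all
`s ≤ N + 1` (coefficients of the two-scale divergence `∑ᵢ (∂_{xᵢ} + ε⁻¹kᵢ∂_θ)` on `∑ ε^a P_a`: `d_0 = k·∂_θP_0`,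
`d_s = ∇ₓ·P_{s-1} + k·∂_θP_s`, `d_{N+1} = ∇ₓ·P_N`; `k = ∇G + j = phaseGrad j G`) and zero means.  Both are AUTOMATIC in
POTENTIAL FORM: the two-scale curls `P_a = ∇ₓ × Ξ_a + k × ∂_θ Ξ_{a+1}` (`∂_θΞ_0 = 0`, `Ξ_a = 0` for `a > N`) of smooth
potentials `Ξ_a : T⁴ → ℝ³` are smooth, satisfy `d_s ≡ 0` (`s ≤ N + 1`) and have zero `T⁴`-means — the registered tools
sub-stub `stub_hierarchyWPotential` (last theorem).  "div ∘ curl = 0" for the two-scale derivatives: `∂_{xᵢ}` and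
`kₗ∂_θ` commute among themselves (`sDeriv_sDeriv_comm`, `fDeriv_fDeriv_comm`) and have a commutator SYMMETRIC in
`(i, l)` (`sDeriv_fDeriv_add_comm`: `[∂_{xᵢ}, kₗ∂_θ] = (∂ᵢkₗ)∂_θ`, `∂ᵢkₗ = ∂ᵢ∂ₗG = ∂ₗkᵢ`); the edge orders use
`∂_θΞ_0 = 0` (`fDeriv_sDeriv_eq_zero`) and `Ξ_{N+1} = 0`; means: `∫ ∂_{xᵢ}u = 0`, `∫ kᵢ∂_θu = −∫ (∂_θkᵢ) u = 0`.
Tools: `Torus.partialDeriv_comm/_mul/_add/_sub`, `Torus.integral_partialDeriv_eq_zero_holds`; `Energy.*`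
(`…HierarchyEnergyTools/Lemmas.lean`), `FormalExpansion.isSmooth_sDeriv/_fDeriv`, `DissipationLaw.slow_add_single_castSucc`,
`Eikonal.divCoeff_zero`, `Unfold.divCoeff_succ/_top`.  Pure calculus on `T⁴`. [folklore]
-/

-- `Summit.<Summit>.<Problem>` is the tree's mandated summit-side namespace (CONVENTIONS §2); for this
-- single-conjunct summit the two coincide, so the duplicate is deliberate.
set_option linter.dupNamespace false

noncomputable section

open scoped BigOperators InnerProductSpace ContDiff
open MeasureTheory
open Literature.Analysis.FunctionSpaces Literature.Analysis.FunctionSpaces.Torus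

namespace Summit.AnomalousDissipation.AnomalousDissipation.Theorems.TaylorWaveQuasiSteady.Potential

open Summit.AnomalousDissipation.AnomalousDissipation.Theorems.TaylorWaveQuasiSteady

variable {F : Type*} [NormedAddCommGroup F] [NormedSpace ℝ F]

/-! ## §1 Slow derivatives of slow functions; the phase gradient is curl-free -/

/-- **Slow derivatives of functions of the slow point**: `∂_{xᵢ} (g ∘ slow) = (∂ᵢ g) ∘ slow`. [folklore] -/
theorem partialDeriv_castSucc_comp_slow (g : UnitAddTorus (Fin 3) → F) (i : Fin 3) (y : UnitAddTorus (Fin 4)) :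
    partialDeriv i.castSucc (fun z : UnitAddTorus (Fin 4) => g (slow z)) y = partialDeriv i g (slow y) := by
  have h : (fun t : ℝ => g (slow (y + Torus.proj (t • EuclideanSpace.single i.castSucc (1 : ℝ))))) =
      fun t : ℝ => g (slow y + Torus.proj (t • EuclideanSpace.single i (1 : ℝ))) := by
    funext t
    rw [proj_smul_single, proj_smul_single, DissipationLaw.slow_add_single_castSucc]
  simp only [Torus.partialDeriv, Torus.lineDeriv]
  rw [h]

/-- **The phase gradient is curl-free on `T⁴`**: `∂_{xₗ}(kᵢ ∘ slow) = ∂_{xᵢ}(kₗ ∘ slow)` (`∂ₗkᵢ = ∂ₗ∂ᵢG`, the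
integer part of `k = ∇G + j` being constant, and mixed partials of the smooth `G` commute). [folklore] -/
theorem partialDeriv_castSucc_phaseGrad_comm (j : Fin 3 → ℤ) {G : UnitAddTorus (Fin 3) → ℝ} (hG : IsSmooth G)
    (l i : Fin 3) (y : UnitAddTorus (Fin 4)) :
    partialDeriv l.castSucc (fun z : UnitAddTorus (Fin 4) => phaseGrad j G i (slow z)) y =
      partialDeriv i.castSucc (fun z : UnitAddTorus (Fin 4) => phaseGrad j G l (slow z)) y := by
  rw [partialDeriv_castSucc_comp_slow (phaseGrad j G i) l y, partialDeriv_castSucc_comp_slow (phaseGrad j G l) i y]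
  simpa only [Torus.partialDeriv, Torus.lineDeriv, phaseGrad, deriv_add_const] using partialDeriv_comm hG l i (slow y)

/-! ## §2 Commutation of slow and weighted fast derivatives of real profiles -/

/-- `fDeriv` of a real profile is the product `kᵢ ∂_θ u`. [folklore] -/
theorem fDeriv_eq_mul (j : Fin 3 → ℤ) (G : UnitAddTorus (Fin 3) → ℝ) (i : Fin 3) (u : UnitAddTorus (Fin 4) → ℝ) :
    fDeriv j G i u = fun y => phaseGrad j G i (slow y) * partialDeriv (Fin.last 3) u y := rfl

/-- `fDeriv` of a real profile, pointwise: `fDeriv j G i u y = kᵢ(slow y) ∂_θ u y`. [folklore] -/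
theorem fDeriv_apply (j : Fin 3 → ℤ) (G : UnitAddTorus (Fin 3) → ℝ) (i : Fin 3) (u : UnitAddTorus (Fin 4) → ℝ)
    (y : UnitAddTorus (Fin 4)) :
    fDeriv j G i u y = phaseGrad j G i (slow y) * partialDeriv (Fin.last 3) u y := rfl

/-- Slow derivatives commute: `∂_{xᵢ}∂_{xₗ} u = ∂_{xₗ}∂_{xᵢ} u`. [folklore] -/
theorem sDeriv_sDeriv_comm {u : UnitAddTorus (Fin 4) → F} (hu : IsSmooth u) (i l : Fin 3) (y : UnitAddTorus (Fin 4)) :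
    sDeriv i (sDeriv l u) y = sDeriv l (sDeriv i u) y :=
  partialDeriv_comm hu i.castSucc l.castSucc y

/-- Weighted fast derivatives commute: `kᵢ∂_θ(kₗ∂_θ u) = kₗ∂_θ(kᵢ∂_θ u)` (both are `kᵢkₗ ∂_θ²u`). [folklore] -/
theorem fDeriv_fDeriv_comm (j : Fin 3 → ℤ) {G : UnitAddTorus (Fin 3) → ℝ} (hG : IsSmooth G)
    {u : UnitAddTorus (Fin 4) → ℝ} (hu : IsSmooth u) (i l : Fin 3) (y : UnitAddTorus (Fin 4)) :
    fDeriv j G i (fDeriv j G l u) y = fDeriv j G l (fDeriv j G i u) y := by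
  have h : ∀ m : Fin 3, partialDeriv (Fin.last 3) (fDeriv j G m u) y =
      phaseGrad j G m (slow y) * partialDeriv (Fin.last 3) (partialDeriv (Fin.last 3) u) y := fun m => by
    rw [fDeriv_eq_mul]
    exact Energy.partialDeriv_last_phaseGrad_mul j hG m (hu.partialDeriv _) y
  rw [fDeriv_apply j G i, fDeriv_apply j G l, h l, h i]
  ring

/-- **Mixed commutator**: `∂_{xᵢ}(kₗ∂_θu) + kᵢ∂_θ(∂_{xₗ}u) = ∂_{xₗ}(kᵢ∂_θu) + kₗ∂_θ(∂_{xᵢ}u)` — the two-scale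
derivatives `∂_{xᵢ} + ε⁻¹kᵢ∂_θ` commute with one another because `k = ∇G + j` is curl-free. [folklore] -/
theorem sDeriv_fDeriv_add_comm (j : Fin 3 → ℤ) {G : UnitAddTorus (Fin 3) → ℝ} (hG : IsSmooth G)
    {u : UnitAddTorus (Fin 4) → ℝ} (hu : IsSmooth u) (i l : Fin 3) (y : UnitAddTorus (Fin 4)) :
    sDeriv i (fDeriv j G l u) y + fDeriv j G i (sDeriv l u) y =
      sDeriv l (fDeriv j G i u) y + fDeriv j G l (sDeriv i u) y := by
  have hk : ∀ m : Fin 3, IsContDiff 1 (fun z : UnitAddTorus (Fin 4) => phaseGrad j G m (slow z)) :=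
    fun m => (Energy.isSmooth_phaseGrad_slow j hG m).isContDiff (by simp)
  have hθu : IsContDiff 1 (partialDeriv (Fin.last 3) u) := (hu.partialDeriv _).isContDiff (by simp)
  have h1 : ∀ m n : Fin 3, sDeriv m (fDeriv j G n u) y =
      phaseGrad j G n (slow y) * partialDeriv m.castSucc (partialDeriv (Fin.last 3) u) y
        + partialDeriv m.castSucc (fun z : UnitAddTorus (Fin 4) => phaseGrad j G n (slow z)) y *
          partialDeriv (Fin.last 3) u y := by
    intro m n
    rw [fDeriv_eq_mul]
    exact partialDeriv_mul (hk n) hθu m.castSucc y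
  have h2 : ∀ m n : Fin 3, fDeriv j G m (sDeriv n u) y =
      phaseGrad j G m (slow y) * partialDeriv n.castSucc (partialDeriv (Fin.last 3) u) y := by
    intro m n
    rw [fDeriv_apply]
    congr 1
    exact partialDeriv_comm hu (Fin.last 3) n.castSucc y
  rw [h1 i l, h1 l i, h2 i l, h2 l i, partialDeriv_castSucc_phaseGrad_comm j hG i l y]
  ring

/-- A slow derivative of a profile WITHOUT fast dependence has no weighted fast derivative:
`∂_θ u ≡ 0 ⇒ kᵢ∂_θ(∂_{xₗ} u) = 0`. [folklore] -/
theorem fDeriv_sDeriv_eq_zero (j : Fin 3 → ℤ) (G : UnitAddTorus (Fin 3) → ℝ) {u : UnitAddTorus (Fin 4) → F}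
    (hu : IsSmooth u) (hu0 : ∀ y, partialDeriv (Fin.last 3) u y = 0) (i l : Fin 3) (y : UnitAddTorus (Fin 4)) :
    fDeriv j G i (sDeriv l u) y = 0 := by
  have h0 : partialDeriv (Fin.last 3) u = fun _ => (0 : F) := funext hu0
  have hc : partialDeriv l.castSucc (fun _ : UnitAddTorus (Fin 4) => (0 : F)) y = 0 := by
    simp [Torus.partialDeriv, Torus.lineDeriv]
  have h1 : partialDeriv (Fin.last 3) (sDeriv l u) y = 0 := by
    have h := partialDeriv_comm hu (Fin.last 3) l.castSucc y
    rwa [h0, hc] at h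
  simp only [fDeriv, h1, smul_zero]

/-! ## §3 Linearity and means of the four-term combinations -/

/-- `f − g + (h − k)` of smooth profiles is smooth. [folklore] -/
theorem isSmooth_lin4 {f g h k : UnitAddTorus (Fin 4) → F} (hf : IsSmooth f) (hg : IsSmooth g) (hh : IsSmooth h)
    (hk : IsSmooth k) : IsSmooth (fun y => f y - g y + (h y - k y)) :=
  (hf.sub hg).add (hh.sub hk)

/-- `∂ₘ (f − g + (h − k)) = ∂ₘf − ∂ₘg + (∂ₘh − ∂ₘk)` for smooth profiles. [folklore] -/
theorem partialDeriv_lin4 {f g h k : UnitAddTorus (Fin 4) → F} (hf : IsSmooth f) (hg : IsSmooth g) (hh : IsSmooth h)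
    (hk : IsSmooth k) (m : Fin 4) (y : UnitAddTorus (Fin 4)) :
    partialDeriv m (fun y => f y - g y + (h y - k y)) y =
      partialDeriv m f y - partialDeriv m g y + (partialDeriv m h y - partialDeriv m k y) := by
  have hf1 : IsContDiff 1 f := hf.isContDiff (by simp)
  have hg1 : IsContDiff 1 g := hg.isContDiff (by simp)
  have hh1 : IsContDiff 1 h := hh.isContDiff (by simp)
  have hk1 : IsContDiff 1 k := hk.isContDiff (by simp)
  have hfg : IsContDiff 1 (f - g) := hf1.sub hg1
  have hhk : IsContDiff 1 (h - k) := hh1.sub hk1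
  have e : (fun y => f y - g y + (h y - k y)) = (f - g) + (h - k) := rfl
  rw [e, partialDeriv_add hfg hhk, Pi.add_apply, partialDeriv_sub hf1 hg1, partialDeriv_sub hh1 hk1, Pi.sub_apply,
    Pi.sub_apply]

/-- `sDeriv` of `f − g + (h − k)`. [folklore] -/
theorem sDeriv_lin4 {f g h k : UnitAddTorus (Fin 4) → F} (hf : IsSmooth f) (hg : IsSmooth g) (hh : IsSmooth h)
    (hk : IsSmooth k) (i : Fin 3) (y : UnitAddTorus (Fin 4)) :
    sDeriv i (fun y => f y - g y + (h y - k y)) y = sDeriv i f y - sDeriv i g y + (sDeriv i h y - sDeriv i k y) :=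
  partialDeriv_lin4 hf hg hh hk i.castSucc y

/-- `fDeriv` of `f − g + (h − k)`. [folklore] -/
theorem fDeriv_lin4 (j : Fin 3 → ℤ) (G : UnitAddTorus (Fin 3) → ℝ) {f g h k : UnitAddTorus (Fin 4) → F}
    (hf : IsSmooth f) (hg : IsSmooth g) (hh : IsSmooth h) (hk : IsSmooth k) (i : Fin 3) (y : UnitAddTorus (Fin 4)) :
    fDeriv j G i (fun y => f y - g y + (h y - k y)) y =
      fDeriv j G i f y - fDeriv j G i g y + (fDeriv j G i h y - fDeriv j G i k y) := by
  simp only [fDeriv, partialDeriv_lin4 hf hg hh hk, smul_add, smul_sub]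

/-- `∫ (f − g + (h − k)) = (∫f − ∫g) + (∫h − ∫k)` for smooth real profiles. [folklore] -/
theorem integral_lin4 {f g h k : UnitAddTorus (Fin 4) → ℝ} (hf : IsSmooth f) (hg : IsSmooth g) (hh : IsSmooth h)
    (hk : IsSmooth k) :
    ∫ y, (f y - g y + (h y - k y)) = ((∫ y, f y) - ∫ y, g y) + ((∫ y, h y) - ∫ y, k y) := by
  have i1 : Integrable (fun y => f y - g y) := hf.integrable.sub hg.integrable
  have i2 : Integrable (fun y => h y - k y) := hh.integrable.sub hk.integrable
  rw [integral_add i1 i2, integral_sub hf.integrable hg.integrable, integral_sub hh.integrable hk.integrable]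

/-- `∫_{T⁴} ∂_{xᵢ} u = 0`. [folklore] -/
theorem integral_sDeriv_eq_zero {u : UnitAddTorus (Fin 4) → ℝ} (hu : IsSmooth u) (i : Fin 3) :
    ∫ y, sDeriv i u y = 0 :=
  integral_partialDeriv_eq_zero_holds hu i.castSucc

/-- `∫_{T⁴} kᵢ ∂_θ u = −∫_{T⁴} (∂_θ kᵢ) u = 0` (the phase gradient has no fast dependence). [folklore] -/
theorem integral_fDeriv_eq_zero (j : Fin 3 → ℤ) {G : UnitAddTorus (Fin 3) → ℝ} (hG : IsSmooth G)
    {u : UnitAddTorus (Fin 4) → ℝ} (hu : IsSmooth u) (i : Fin 3) :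
    ∫ y, fDeriv j G i u y = 0 := by
  have h := Energy.integral_partialDeriv_mul_eq_neg hu (Energy.isSmooth_phaseGrad_slow j hG i) (Fin.last 3)
  have h0 : ∀ y, partialDeriv (Fin.last 3) (fun z : UnitAddTorus (Fin 4) => phaseGrad j G i (slow z)) y = 0 :=
    fun y => Energy.partialDeriv_last_comp_slow (fun x => phaseGrad j G i x) y
  simp_rw [h0, mul_zero, integral_zero, neg_zero] at h
  have e : ∀ y, fDeriv j G i u y = partialDeriv (Fin.last 3) u y * phaseGrad j G i (slow y) :=
    fun y => by rw [fDeriv_apply, mul_comm]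
  simpa only [e] using h

/-! ## §4 Fields given by three real components -/

section Vec

variable {V : UnitAddTorus (Fin 4) → EuclideanSpace ℝ (Fin 3)} {e0 e1 e2 : UnitAddTorus (Fin 4) → ℝ}
  (hV : ∀ y, V y = WithLp.toLp 2 ![e0 y, e1 y, e2 y])

include hV

/-- Components of a field given componentwise. [folklore] -/
theorem apply_eq_of_vec3 (y : UnitAddTorus (Fin 4)) : V y 0 = e0 y ∧ V y 1 = e1 y ∧ V y 2 = e2 y := by
  rw [hV y]
  exact ⟨rfl, rfl, rfl⟩

variable (h0 : IsSmooth e0) (h1 : IsSmooth e1) (h2 : IsSmooth e2)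

include h0 h1 h2

/-- A field with three smooth components is smooth. [folklore] -/
theorem isSmooth_of_vec3 : IsSmooth V := by
  rw [show V = fun y => (WithLp.toLp 2 ![e0 y, e1 y, e2 y] : EuclideanSpace ℝ (Fin 3)) from funext hV]
  unfold IsSmooth
  rw [contDiff_piLp]
  intro i
  fin_cases i
  exacts [h0, h1, h2]

/-- **Slow divergence in components**: `∑ᵢ (∂_{xᵢ} V)ᵢ = ∂_{x₀}V₀ + ∂_{x₁}V₁ + ∂_{x₂}V₂`. [folklore] -/
theorem fsum_sDeriv_apply (y : UnitAddTorus (Fin 4)) :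
    ∑ i : Fin 3, (sDeriv i V y) i = sDeriv 0 e0 y + sDeriv 1 e1 y + sDeriv 2 e2 y := by
  have hV1 : IsContDiff 1 V := (isSmooth_of_vec3 hV h0 h1 h2).isContDiff (by simp)
  have hc := apply_eq_of_vec3 hV
  simp only [Fin.sum_univ_three, sDeriv]
  rw [← Energy.partialDeriv_apply_coord' hV1, ← Energy.partialDeriv_apply_coord' hV1,
    ← Energy.partialDeriv_apply_coord' hV1]
  simp only [(hc _).1, (hc _).2.1, (hc _).2.2]

/-- **Weighted fast divergence in components**: `∑ᵢ (kᵢ∂_θ V)ᵢ = k₀∂_θV₀ + k₁∂_θV₁ + k₂∂_θV₂`. [folklore] -/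
theorem fsum_fDeriv_apply (j : Fin 3 → ℤ) (G : UnitAddTorus (Fin 3) → ℝ) (y : UnitAddTorus (Fin 4)) :
    ∑ i : Fin 3, (fDeriv j G i V y) i = fDeriv j G 0 e0 y + fDeriv j G 1 e1 y + fDeriv j G 2 e2 y := by
  have hV1 : IsContDiff 1 V := (isSmooth_of_vec3 hV h0 h1 h2).isContDiff (by simp)
  have hc := apply_eq_of_vec3 hV
  simp only [Fin.sum_univ_three, fDeriv, PiLp.smul_apply, smul_eq_mul]
  rw [← Energy.partialDeriv_apply_coord' hV1, ← Energy.partialDeriv_apply_coord' hV1,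
    ← Energy.partialDeriv_apply_coord' hV1]
  simp only [(hc _).1, (hc _).2.1, (hc _).2.2]

/-- **Means in components**: `(∫ V)ᵢ = ∫ Vᵢ` for the given components. [folklore] -/
theorem integral_apply_of_vec3 :
    (∫ y, V y) 0 = ∫ y, e0 y ∧ (∫ y, V y) 1 = ∫ y, e1 y ∧ (∫ y, V y) 2 = ∫ y, e2 y := by
  have hVi : Integrable V := (isSmooth_of_vec3 hV h0 h1 h2).integrable
  have happ : ∀ l : Fin 3, (∫ y, V y) l = ∫ y, (V y) l := fun l => by
    simpa only [PiLp.proj_apply] using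
      ((EuclideanSpace.proj l : EuclideanSpace ℝ (Fin 3) →L[ℝ] ℝ).integral_comp_comm hVi).symm
  have hc := apply_eq_of_vec3 hV
  simp only [happ, (hc _).1, (hc _).2.1, (hc _).2.2, and_self]

end Vec

/-! ## §5 Two-scale curls `V = ∇ₓ × A + k × ∂_θ B` -/

section Curl

variable (j : Fin 3 → ℤ) {G : UnitAddTorus (Fin 3) → ℝ} {A B C V W : UnitAddTorus (Fin 4) → EuclideanSpace ℝ (Fin 3)}
  (hG : IsSmooth G) (hA : IsSmooth A) (hB : IsSmooth B)
  (hV : ∀ y, V y = WithLp.toLp 2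
    ![sDeriv 1 (fun z => (A z) 2) y - sDeriv 2 (fun z => (A z) 1) y +
        (fDeriv j G 1 (fun z => (B z) 2) y - fDeriv j G 2 (fun z => (B z) 1) y),
      sDeriv 2 (fun z => (A z) 0) y - sDeriv 0 (fun z => (A z) 2) y +
        (fDeriv j G 2 (fun z => (B z) 0) y - fDeriv j G 0 (fun z => (B z) 2) y),
      sDeriv 0 (fun z => (A z) 1) y - sDeriv 1 (fun z => (A z) 0) y +
        (fDeriv j G 0 (fun z => (B z) 1) y - fDeriv j G 1 (fun z => (B z) 0) y)])

include hG hA hB hV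

/-- **Two-scale curls are smooth**: `V = ∇ₓ × A + k × ∂_θ B` is smooth for smooth `G`, `A`, `B`. [folklore] -/
theorem isSmooth_curl : IsSmooth V := by
  have hsA : ∀ l m, IsSmooth (sDeriv l (fun z => (A z) m)) :=
    fun l m => FormalExpansion.isSmooth_sDeriv (Energy.isSmooth_coord hA m) l
  have hfB : ∀ l m, IsSmooth (fDeriv j G l (fun z => (B z) m)) :=
    fun l m => FormalExpansion.isSmooth_fDeriv j hG l (Energy.isSmooth_coord hB m)
  exact isSmooth_of_vec3 hV (isSmooth_lin4 (hsA 1 2) (hsA 2 1) (hfB 1 2) (hfB 2 1))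
    (isSmooth_lin4 (hsA 2 0) (hsA 0 2) (hfB 2 0) (hfB 0 2)) (isSmooth_lin4 (hsA 0 1) (hsA 1 0) (hfB 0 1) (hfB 1 0))

/-- **Zero means**: every component of a two-scale curl is a sum of slow and weighted fast derivatives of smooth
profiles, hence integrates to zero over `T⁴`. [folklore] -/
theorem integral_curl_apply (i : Fin 3) : (∫ y, V y) i = 0 := by
  have hsA : ∀ l m, IsSmooth (sDeriv l (fun z => (A z) m)) :=
    fun l m => FormalExpansion.isSmooth_sDeriv (Energy.isSmooth_coord hA m) l
  have hfB : ∀ l m, IsSmooth (fDeriv j G l (fun z => (B z) m)) :=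
    fun l m => FormalExpansion.isSmooth_fDeriv j hG l (Energy.isSmooth_coord hB m)
  have hzA : ∀ l m, ∫ y, sDeriv l (fun z => (A z) m) y = 0 :=
    fun l m => integral_sDeriv_eq_zero (Energy.isSmooth_coord hA m) l
  have hzB : ∀ l m, ∫ y, fDeriv j G l (fun z => (B z) m) y = 0 :=
    fun l m => integral_fDeriv_eq_zero j hG (Energy.isSmooth_coord hB m) l
  have hI := integral_apply_of_vec3 hV (isSmooth_lin4 (hsA 1 2) (hsA 2 1) (hfB 1 2) (hfB 2 1))
    (isSmooth_lin4 (hsA 2 0) (hsA 0 2) (hfB 2 0) (hfB 0 2)) (isSmooth_lin4 (hsA 0 1) (hsA 1 0) (hfB 0 1) (hfB 1 0))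
  rw [integral_lin4 (hsA 1 2) (hsA 2 1) (hfB 1 2) (hfB 2 1), integral_lin4 (hsA 2 0) (hsA 0 2) (hfB 2 0) (hfB 0 2),
    integral_lin4 (hsA 0 1) (hsA 1 0) (hfB 0 1) (hfB 1 0)] at hI
  simp only [hzA, hzB, sub_zero, add_zero] at hI
  fin_cases i
  exacts [hI.1, hI.2.1, hI.2.2]

/-- **Slow divergence of a two-scale curl, expanded**: `∑ᵢ (∂_{xᵢ}V)ᵢ` as the twelve second-order terms
`∂_{xᵢ}∂_{xₗ}Aₘ`, `∂_{xᵢ}(kₗ∂_θBₘ)`. [folklore] -/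
theorem fsum_sDeriv_curl (y : UnitAddTorus (Fin 4)) :
    ∑ i : Fin 3, (sDeriv i V y) i =
      (sDeriv 0 (sDeriv 1 (fun z => (A z) 2)) y - sDeriv 0 (sDeriv 2 (fun z => (A z) 1)) y +
          (sDeriv 0 (fDeriv j G 1 (fun z => (B z) 2)) y - sDeriv 0 (fDeriv j G 2 (fun z => (B z) 1)) y))
      + (sDeriv 1 (sDeriv 2 (fun z => (A z) 0)) y - sDeriv 1 (sDeriv 0 (fun z => (A z) 2)) y +
          (sDeriv 1 (fDeriv j G 2 (fun z => (B z) 0)) y - sDeriv 1 (fDeriv j G 0 (fun z => (B z) 2)) y))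
      + (sDeriv 2 (sDeriv 0 (fun z => (A z) 1)) y - sDeriv 2 (sDeriv 1 (fun z => (A z) 0)) y +
          (sDeriv 2 (fDeriv j G 0 (fun z => (B z) 1)) y - sDeriv 2 (fDeriv j G 1 (fun z => (B z) 0)) y)) := by
  have hsA : ∀ l m, IsSmooth (sDeriv l (fun z => (A z) m)) :=
    fun l m => FormalExpansion.isSmooth_sDeriv (Energy.isSmooth_coord hA m) l
  have hfB : ∀ l m, IsSmooth (fDeriv j G l (fun z => (B z) m)) :=
    fun l m => FormalExpansion.isSmooth_fDeriv j hG l (Energy.isSmooth_coord hB m)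
  rw [fsum_sDeriv_apply hV (isSmooth_lin4 (hsA 1 2) (hsA 2 1) (hfB 1 2) (hfB 2 1))
    (isSmooth_lin4 (hsA 2 0) (hsA 0 2) (hfB 2 0) (hfB 0 2)) (isSmooth_lin4 (hsA 0 1) (hsA 1 0) (hfB 0 1) (hfB 1 0)) y,
    sDeriv_lin4 (hsA 1 2) (hsA 2 1) (hfB 1 2) (hfB 2 1), sDeriv_lin4 (hsA 2 0) (hsA 0 2) (hfB 2 0) (hfB 0 2),
    sDeriv_lin4 (hsA 0 1) (hsA 1 0) (hfB 0 1) (hfB 1 0)]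

/-- **Weighted fast divergence of a two-scale curl, expanded**: `∑ᵢ (kᵢ∂_θV)ᵢ` as the twelve second-order terms
`kᵢ∂_θ(∂_{xₗ}Aₘ)`, `kᵢ∂_θ(kₗ∂_θBₘ)`. [folklore] -/
theorem fsum_fDeriv_curl (y : UnitAddTorus (Fin 4)) :
    ∑ i : Fin 3, (fDeriv j G i V y) i =
      (fDeriv j G 0 (sDeriv 1 (fun z => (A z) 2)) y - fDeriv j G 0 (sDeriv 2 (fun z => (A z) 1)) y +
          (fDeriv j G 0 (fDeriv j G 1 (fun z => (B z) 2)) y - fDeriv j G 0 (fDeriv j G 2 (fun z => (B z) 1)) y))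
      + (fDeriv j G 1 (sDeriv 2 (fun z => (A z) 0)) y - fDeriv j G 1 (sDeriv 0 (fun z => (A z) 2)) y +
          (fDeriv j G 1 (fDeriv j G 2 (fun z => (B z) 0)) y - fDeriv j G 1 (fDeriv j G 0 (fun z => (B z) 2)) y))
      + (fDeriv j G 2 (sDeriv 0 (fun z => (A z) 1)) y - fDeriv j G 2 (sDeriv 1 (fun z => (A z) 0)) y +
          (fDeriv j G 2 (fDeriv j G 0 (fun z => (B z) 1)) y - fDeriv j G 2 (fDeriv j G 1 (fun z => (B z) 0)) y)) := by
  have hsA : ∀ l m, IsSmooth (sDeriv l (fun z => (A z) m)) :=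
    fun l m => FormalExpansion.isSmooth_sDeriv (Energy.isSmooth_coord hA m) l
  have hfB : ∀ l m, IsSmooth (fDeriv j G l (fun z => (B z) m)) :=
    fun l m => FormalExpansion.isSmooth_fDeriv j hG l (Energy.isSmooth_coord hB m)
  rw [fsum_fDeriv_apply hV (isSmooth_lin4 (hsA 1 2) (hsA 2 1) (hfB 1 2) (hfB 2 1))
    (isSmooth_lin4 (hsA 2 0) (hsA 0 2) (hfB 2 0) (hfB 0 2)) (isSmooth_lin4 (hsA 0 1) (hsA 1 0) (hfB 0 1) (hfB 1 0)) j G y,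
    fDeriv_lin4 j G (hsA 1 2) (hsA 2 1) (hfB 1 2) (hfB 2 1), fDeriv_lin4 j G (hsA 2 0) (hsA 0 2) (hfB 2 0) (hfB 0 2),
    fDeriv_lin4 j G (hsA 0 1) (hsA 1 0) (hfB 0 1) (hfB 1 0)]

/-- **Order `0`: `k · ∂_θ V = 0`** for `V = ∇ₓ × A + k × ∂_θ B` when `A` has no fast dependence
(`k·∂_θ(∇ₓ × A) = k·∇ₓ × ∂_θA = 0` and `k·(k × ∂_θ²B) = 0`). [folklore] -/
theorem fsum_fDeriv_curl_eq_zero (hA0 : ∀ y, partialDeriv (Fin.last 3) A y = 0) (y : UnitAddTorus (Fin 4)) :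
    ∑ i : Fin 3, (fDeriv j G i V y) i = 0 := by
  have hA1 : IsContDiff 1 A := hA.isContDiff (by simp)
  have hA0' : ∀ (m : Fin 3) (y : UnitAddTorus (Fin 4)), partialDeriv (Fin.last 3) (fun z => (A z) m) y = 0 := by
    intro m y
    rw [Energy.partialDeriv_apply_coord' hA1 (Fin.last 3) y m, hA0 y]
    rfl
  have hz : ∀ i l m, fDeriv j G i (sDeriv l (fun z => (A z) m)) y = 0 :=
    fun i l m => fDeriv_sDeriv_eq_zero j G (Energy.isSmooth_coord hA m) (hA0' m) i l y
  have hBc : ∀ m, IsSmooth (fun z => (B z) m) := fun m => Energy.isSmooth_coord hB m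
  rw [fsum_fDeriv_curl j hG hA hB hV y]
  simp only [hz]
  linarith [fDeriv_fDeriv_comm j hG (hBc 2) 0 1 y, fDeriv_fDeriv_comm j hG (hBc 0) 1 2 y,
    fDeriv_fDeriv_comm j hG (hBc 1) 2 0 y]

/-- **Top order: `∇ₓ · V = 0`** for `V = ∇ₓ × A + k × ∂_θ B` with `B ≡ 0` (`div curl = 0`). [folklore] -/
theorem fsum_sDeriv_curl_eq_zero (hB0 : ∀ y, B y = 0) (y : UnitAddTorus (Fin 4)) :
    ∑ i : Fin 3, (sDeriv i V y) i = 0 := by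
  have hAc : ∀ m, IsSmooth (fun z => (A z) m) := fun m => Energy.isSmooth_coord hA m
  have hz : ∀ i l m, sDeriv i (fDeriv j G l (fun z => (B z) m)) y = 0 := fun i l m => by
    simp [hB0, sDeriv, fDeriv, Torus.partialDeriv, Torus.lineDeriv]
  rw [fsum_sDeriv_curl j hG hA hB hV y]
  simp only [hz]
  linarith [sDeriv_sDeriv_comm (hAc 2) 0 1 y, sDeriv_sDeriv_comm (hAc 0) 1 2 y, sDeriv_sDeriv_comm (hAc 1) 2 0 y]

/-- **Intermediate orders: `∇ₓ · V + k · ∂_θ W = 0`** for consecutive two-scale curls `V = ∇ₓ × A + k × ∂_θ B`,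
`W = ∇ₓ × B + k × ∂_θ C`: `∇ₓ·∇ₓ× = 0`, `k∂_θ · k∂_θ× = 0`, and the cross terms cancel because `∂_{xᵢ}` and
`kₗ∂_θ` have a symmetric commutator (`k` curl-free). [folklore] -/
theorem fsum_sDeriv_add_fsum_fDeriv_curl_eq_zero (hC : IsSmooth C)
    (hW : ∀ y, W y = WithLp.toLp 2
      ![sDeriv 1 (fun z => (B z) 2) y - sDeriv 2 (fun z => (B z) 1) y +
          (fDeriv j G 1 (fun z => (C z) 2) y - fDeriv j G 2 (fun z => (C z) 1) y),
        sDeriv 2 (fun z => (B z) 0) y - sDeriv 0 (fun z => (B z) 2) y +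
          (fDeriv j G 2 (fun z => (C z) 0) y - fDeriv j G 0 (fun z => (C z) 2) y),
        sDeriv 0 (fun z => (B z) 1) y - sDeriv 1 (fun z => (B z) 0) y +
          (fDeriv j G 0 (fun z => (C z) 1) y - fDeriv j G 1 (fun z => (C z) 0) y)]) (y : UnitAddTorus (Fin 4)) :
    (∑ i : Fin 3, (sDeriv i V y) i) + ∑ i : Fin 3, (fDeriv j G i W y) i = 0 := by
  have hAc : ∀ m, IsSmooth (fun z => (A z) m) := fun m => Energy.isSmooth_coord hA m
  have hBc : ∀ m, IsSmooth (fun z => (B z) m) := fun m => Energy.isSmooth_coord hB m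
  have hCc : ∀ m, IsSmooth (fun z => (C z) m) := fun m => Energy.isSmooth_coord hC m
  rw [fsum_sDeriv_curl j hG hA hB hV y, fsum_fDeriv_curl j hG hB hC hW y]
  linarith [sDeriv_sDeriv_comm (hAc 2) 0 1 y, sDeriv_sDeriv_comm (hAc 0) 1 2 y, sDeriv_sDeriv_comm (hAc 1) 2 0 y,
    fDeriv_fDeriv_comm j hG (hCc 2) 0 1 y, fDeriv_fDeriv_comm j hG (hCc 0) 1 2 y,
    fDeriv_fDeriv_comm j hG (hCc 1) 2 0 y, sDeriv_fDeriv_add_comm j hG (hBc 2) 0 1 y,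
    sDeriv_fDeriv_add_comm j hG (hBc 0) 1 2 y, sDeriv_fDeriv_add_comm j hG (hBc 1) 2 0 y]

end Curl

/-! ## §6 The registered tools sub-stub -/

/-- **stub_hierarchyWPotential** (registered tools sub-stub of stmt-AnomalousDissipation-16293, potential form of
the open core `stub_hierarchyW`): profiles given by two-scale curls of smooth potentials,
`P_a = ∇ₓ × Ξ_a + k × ∂_θ Ξ_{a+1}` (`Ξ_0` without fast dependence, `Ξ_a = 0` for `a > N`), are smooth, satisfy EVERY
formal incompressibility constraint `divCoeff … s ≡ 0` (`s ≤ N + 1`), and have zero `T⁴`-means: by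
`Eikonal.divCoeff_zero`, `Unfold.divCoeff_succ`, `Unfold.divCoeff_top` the three shapes of `d_s` are the three
vanishing lemmas of §5. [folklore] -/
theorem stub_hierarchyWPotential : ∀ (j : Fin 3 → ℤ) (G : UnitAddTorus (Fin 3) → ℝ) (N : ℕ) (Ξ P : ℕ → UnitAddTorus (Fin 4) → EuclideanSpace ℝ (Fin 3)), Literature.Analysis.FunctionSpaces.Torus.IsSmooth G → (∀ a, Literature.Analysis.FunctionSpaces.Torus.IsSmooth (Ξ a)) → (∀ y, Literature.Analysis.FunctionSpaces.Torus.partialDeriv (Fin.last 3) (Ξ 0) y = 0) → (∀ a, N < a → ∀ y, Ξ a y = 0) → (∀ a y, P a y = WithLp.toLp 2 ![sDeriv 1 (fun z => (Ξ a z) 2) y - sDeriv 2 (fun z => (Ξ a z) 1) y + (fDeriv j G 1 (fun z => (Ξ (a + 1) z) 2) y - fDeriv j G 2 (fun z => (Ξ (a + 1) z) 1) y), sDeriv 2 (fun z => (Ξ a z) 0) y - sDeriv 0 (fun z => (Ξ a z) 2) y + (fDeriv j G 2 (fun z => (Ξ (a + 1) z) 0) y - fDeriv j G 0 (fun z =>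 (Ξ (a + 1) z) 2) y), sDeriv 0 (fun z => (Ξ a z) 1) y - sDeriv 1 (fun z => (Ξ a z) 0) y + (fDeriv j G 0 (fun z => (Ξ (a + 1) z) 1) y - fDeriv j G 1 (fun z => (Ξ (a + 1) z) 0) y)]) → (∀ a, Literature.Analysis.FunctionSpaces.Torus.IsSmooth (P a)) ∧ (∀ s, s ≤ N + 1 → ∀ y, divCoeff j G N P s y = 0) ∧ (∀ (a : ℕ) (i : Fin 3), (∫ y, P a y) i = 0) := by
  intro j G N Ξ P hG hΞ hΞ0 hΞN hP
  refine ⟨fun a => isSmooth_curl j hG (hΞ a) (hΞ (a + 1)) (hP a), fun s hs y => ?_,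
    fun a i => integral_curl_apply j hG (hΞ a) (hΞ (a + 1)) (hP a) i⟩
  rcases s with _ | t
  · rw [Eikonal.divCoeff_zero j G N P y]
    exact fsum_fDeriv_curl_eq_zero j hG (hΞ 0) (hΞ (0 + 1)) (hP 0) hΞ0 y
  · rcases Nat.lt_or_ge (t + 1) (N + 1) with hlt | hge
    · rw [Unfold.divCoeff_succ j G N P t (by omega) y]
      exact fsum_sDeriv_add_fsum_fDeriv_curl_eq_zero j hG (hΞ t) (hΞ (t + 1)) (hP t) (hΞ (t + 1 + 1))
        (hP (t + 1)) y
    · have ht : t = N := by omega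
      rw [ht, Unfold.divCoeff_top j G N P y]
      exact fsum_sDeriv_curl_eq_zero j hG (hΞ N) (hΞ (N + 1)) (hP N) (hΞN (N + 1) (Nat.lt_succ_self N)) y

end Summit.AnomalousDissipation.AnomalousDissipation.Theorems.TaylorWaveQuasiSteady.Potential

end
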